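import Summits.ResolutionOfSingularities.ResolutionOfSingularities.Theorems.DeltaCutChain
import HarnessLib

/-!
# DeltaCutChain2 — decomp-res node «ChainCut» (lens-6 g24, critic row 185 CLEARED DECIDED +1 · MAP 0), tree file 2/5 of the node

Content VERBATIM from the decomp-res lens-6 g24 node `HOME/decomp-res-lens-6/g24/ChainCut.lean` (pin dd25c369;
imports the landed tree only, carries nothing); HOME = run/shared/lean/pub/decomp-res; critic row 185 CLEARED
DECIDED +1 · MAP 0; landing orders INBOX :962/:964/:980 — provenance, critic text and the lens header in full in the
first file of the node, `DeltaCutChain`.  Namespace `…Theorems.DeltaCutClasses`; `--supports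
stmt-ResolutionOfSingularities-26971`.

## This file

Continuation 2/3 of `DeltaCutChain` (same sections of the node, cut at the 400-line cap): carries
`isRegular_subscheme_vanishingIdeal_finset`, `isDatum_transform_blowup`, `deltaLightAt_of_chainLightAt_fac`,
`wor_of_chainTame`, `wor_of_isolated_chainTame`, `worTopDeltaHeavyChainTame_of_five`,
`e1TopDeltaHeavyChainTame_of_five`, `e1TopDeltaHeavy_iff_e1TopChainHeavy`, `worTopDeltaHeavy_iff_worTopChainHeavy`,
`e1TopHeavy_iff_e1TopChainHeavy`, `e1TopNoAbs_iff_e1TopChainHeavy`, `e_one_iff_e1TopChainHeavy`, `TopBadInfinite`,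
`TopFiniteChainHeavy`, `topChainHeavy_iff_badInfinite_or_finiteChainHeavy`,
`not_topBadInfinite_and_topFiniteChainHeavy`, `topFiniteChainHeavy_of_not_topBadInfinite`, `WORTopBadInfinite`,
`WORTopFiniteChainHeavy`, `E1TopBadInfinite`, `E1TopFiniteChainHeavy`.

[WRITER NOTE (decomp-res writer g12): file split only (tree files ≤ 400 lines); namespace, sections, section
variables / opens and every declaration exactly as in the lens (the node's global dupNamespace-linter line is
dropped — the library sets it).]

(Sources: Hironaka1967 (characteristic polyhedra); CossartJannsenSaito2020 Def. 3.13 / Thm. 3.14, Ch. 8, Thm. 9.6;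
Hironaka1970 (near points / vertices); CossartPiltant2019 Prop. 2.6 (δ at chart origins); CossartPiltant2008 §2;
Giraud1975; Hironaka2005 (three key theorems: order under permissible blow-up); EGAIV4 §16–§17; StacksProject 0804 /
0BIQ / 031I; Matsumura1987 §28.)
-/

noncomputable section

open CategoryTheory CategoryTheory.Limits AlgebraicGeometry TopologicalSpace IsLocalRing
open Literature.AlgebraicGeometry.Resolution

universe u

namespace Summit.ResolutionOfSingularities.ResolutionOfSingularities.Theorems.DeltaCutClasses

open Summit.ResolutionOfSingularities.ResolutionOfSingularities.Theorems.TwistCutClasses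
open Summit.ResolutionOfSingularities.ResolutionOfSingularities.Theorems.LightCutClasses

section ChainEngine

open Summit.ResolutionOfSingularities.ResolutionOfSingularities.Theorems
open WeakOrderReduction ForcedTowerClasses SubfieldContactClasses AbsoluteContactClasses PurityValveClasses
open Scheme.IdealSheafData (vanishingIdeal)

/-- **THE REDUCED FINITE SET OF CLOSED POINTS IS A REGULAR CENTRE** (induction on the finite set: `𝓘(S) = 𝓘{a}·𝓘(S∖a)` for
disjoint pieces, `vanishingIdeal_sup_eq_mul_of_disjoint`; a product of regular centres with disjoint supports is regular,
`isRegular_subscheme_mul_of_disjoint_support`; a reduced closed point is regular,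
`isRegular_subscheme_vanishingIdeal_singleton`).
[folklore] -/
theorem isRegular_subscheme_vanishingIdeal_finset {Y : Scheme.{0}} [IsLocallyNoetherian Y] (s : Finset Y)
    (hcl : ∀ y ∈ s, IsClosed ({y} : Set Y)) (hSc : IsClosed ((s : Set Y))) :
    Scheme.IsRegular (vanishingIdeal ⟨(s : Set Y), hSc⟩).subscheme := by
  classical
  induction s using Finset.induction_on with
  | empty =>
    have h0 : (⟨((∅ : Finset Y) : Set Y), hSc⟩ : Closeds Y) = ⊥ := Closeds.ext (by simp)
    rw [h0, Scheme.IdealSheafData.vanishingIdeal_bot]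
    exact isRegular_subscheme_top
  | insert a s ha ih =>
    have hac : IsClosed ({a} : Set Y) := hcl a (Finset.mem_insert_self a s)
    have hcl' : ∀ y ∈ s, IsClosed ({y} : Set Y) := fun y hy => hcl y (Finset.mem_insert_of_mem hy)
    have hsc : IsClosed ((s : Set Y)) := isClosed_of_finite_of_isClosed_singleton s.finite_toSet hcl'
    have hdisj : Disjoint ({a} : Set Y) (s : Set Y) := Set.disjoint_singleton_left.mpr (by exact_mod_cast ha)
    have heq : (⟨((insert a s : Finset Y) : Set Y), hSc⟩ : Closeds Y) = (⟨{a}, hac⟩ : Closeds Y) ⊔ ⟨(s : Set Y), hsc⟩ :=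
      Closeds.ext (by rw [Closeds.coe_sup]; push_cast; exact Set.insert_eq a (s : Set Y))
    rw [heq, vanishingIdeal_sup_eq_mul_of_disjoint hdisj]
    refine isRegular_subscheme_mul_of_disjoint_support (isRegular_subscheme_vanishingIdeal_singleton hac) (ih hcl' hsc) ?_
    rw [coe_support_vanishingIdeal, coe_support_vanishingIdeal]
    exact hdisj

/-- **THE TRANSFORM ALONG A REGULAR CENTRE INSIDE THE ORDER-`n` LOCUS IS AN `n`-DATUM** (Hironaka 2005 basic fact for regular
equimultiple centres, tree `Hironaka2005.idealOrder_controlledTransform_le_of_isRegular`). [folklore] -/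
theorem isDatum_transform_blowup {k : Type} [Field k] {Y : Scheme.{0}} {g : Y ⟶ Spec (.of k)} (hB : IsBase Y g) {n : ℕ}
    {M : MarkedIdeal Y} (hM : IsDatum n M) {C : Y.IdealSheafData} (hCreg : Scheme.IsRegular C.subscheme)
    (hCtop : ∀ y ∈ (C.support : Set Y), idealOrder M.ideal y = ((n : ℕ) : ℕ∞)) :
    IsDatum n (M.transform (blowup.π C) C) := by
  haveI := hB.locallyOfFiniteType
  haveI : IsLocallyNoetherian Y := LocallyOfFiniteType.isLocallyNoetherian g
  haveI : IsLocallyNoetherian (blowup C) := (blowup.isBlowup C).isLocallyNoetherian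
  refine ⟨by rw [MarkedIdeal.transform_mult, hM.1], fun x' => ?_⟩
  rw [MarkedIdeal.transform_ideal, hM.1]
  exact Hironaka2005.idealOrder_controlledTransform_le_of_isRegular hB.isRegular hCreg (blowup.isBlowup C) hCtop hM.2 x'

variable {Y Y' : Scheme.{0}} {π : Y' ⟶ Y}

/-- **THE CHAIN LETTER READ THROUGH A SPLIT BLOW-UP** (core of the engine).  Blow up `𝓘{y₀} · 𝓘(Z₂)` with `y₀ ∉ Z₂`: the blow-up
FACTORS as `τ₂ ≫ τ₁`, `τ₁` the point blow-up at `y₀`, `τ₂` the blow-up of `τ₁^*𝓘(Z₂)` (Literature `IsBlowup.exists_fac_of_mul`,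
Stacks 080A), the controlled transform is the ITERATED one (`IsBlowup.controlledTransform_comp_of_disjoint`, BGMW §3.2), and a
point `y'` over `y₀` lies OFF the second centre, where `τ₂` is a stalk isomorphism: so `y'` wild upstairs ⟹ `τ₂ y'`
is a WILD NEAR
POINT of `y₀` ⟹ δ-light by the chain letter ⟹ `y'` δ-light (off-centre invariances of closedness, order, absolute contact and
δ-lightness). [new] [folklore] -/
theorem deltaLightAt_of_chainLightAt_fac [IsLocallyNoetherian Y] {y₀ : Y} (hy₀ : IsClosed ({y₀} : Set Y)) {Z₂ : Closeds Y}
    (hZ₂ : y₀ ∉ (Z₂ : Set Y)) (hπ : IsBlowup π (vanishingIdeal ⟨{y₀}, hy₀⟩ * vanishingIdeal Z₂)) {I : Y.IdealSheafData}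
    {n : ℕ} (hcl : ChainLightAt I n y₀) {y' : Y'} (hy' : π.base y' = y₀) (hy'c : IsClosed ({y'} : Set Y'))
    (hord : idealOrder (controlledTransform π (vanishingIdeal ⟨{y₀}, hy₀⟩ * vanishingIdeal Z₂) I n) y' = ((n : ℕ) : ℕ∞))
    (hna : ¬ IsAbsContactAt (controlledTransform π (vanishingIdeal ⟨{y₀}, hy₀⟩ * vanishingIdeal Z₂) I n) n y') :
    DeltaLightAt (controlledTransform π (vanishingIdeal ⟨{y₀}, hy₀⟩ * vanishingIdeal Z₂) I n) n y' := by
  have hC₁supp : ((vanishingIdeal ⟨{y₀}, hy₀⟩).support : Set Y) = {y₀} := coe_support_vanishingIdeal _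
  have hdisj : Disjoint ((vanishingIdeal ⟨{y₀}, hy₀⟩).support : Set Y) ((vanishingIdeal Z₂).support : Set Y) := by
    rw [hC₁supp, coe_support_vanishingIdeal]
    exact Set.disjoint_singleton_left.mpr hZ₂
  have hτ₁ := blowup.isBlowup (vanishingIdeal ⟨{y₀}, hy₀⟩)
  haveI : IsLocallyNoetherian (blowup (vanishingIdeal ⟨{y₀}, hy₀⟩)) := hτ₁.isLocallyNoetherian
  haveI : IsLocallyNoetherian Y' := hπ.isLocallyNoetherian
  obtain ⟨τ₂, hτ₂, hfac⟩ := hπ.exists_fac_of_mul hτ₁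
  subst hfac
  rw [IsBlowup.controlledTransform_comp_of_disjoint hτ₁ hτ₂ hdisj I n] at hord hna ⊢
  have hz : (blowup.π (vanishingIdeal ⟨{y₀}, hy₀⟩)).base (τ₂.base y') = y₀ := hy'
  have hz2 : τ₂.base y' ∉ (((vanishingIdeal Z₂).comap (blowup.π (vanishingIdeal ⟨{y₀}, hy₀⟩))).support :
      Set (blowup (vanishingIdeal ⟨{y₀}, hy₀⟩))) := by
    rw [Scheme.IdealSheafData.support_comap, TopologicalSpace.Closeds.coe_preimage, Set.mem_preimage]
    intro h
    have h' : (blowup.π (vanishingIdeal ⟨{y₀}, hy₀⟩)).base (τ₂.base y') ∈ ((vanishingIdeal Z₂).support : Set Y) := h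
    rw [hz, coe_support_vanishingIdeal] at h'
    exact hZ₂ h'
  have hzc : IsClosed ({τ₂.base y'} : Set (blowup (vanishingIdeal ⟨{y₀}, hy₀⟩))) := by
    haveI := hτ₂.isProper
    have := τ₂.isClosedMap _ hy'c
    rwa [Set.image_singleton] at this
  rw [hτ₂.idealOrder_controlledTransform_of_not_mem _ n hz2] at hord
  rw [isAbsContactAt_transform_iff_of_not_mem hτ₂ _ n n hz2] at hna
  rw [deltaLightAt_transform_iff_of_not_mem hτ₂ _ n n hz2]
  exact hcl _ _ (blowup.π (vanishingIdeal ⟨{y₀}, hy₀⟩)) hC₁supp (isRegular_subscheme_vanishingIdeal_singleton hy₀) hτ₁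
    _ hz hzc hord hna

/-- **THE ONE-SHOT ENGINE · the decided cell closes.**  If the bad set `S` of an `n`-datum is FINITE and every bad point is
CHAIN-LIGHT then the datum has a weak resolution, given `SeqDimFour 5 n`: the reduced ideal `𝓘(S)` is a regular
centre inside the
top locus (weakly admissible, `isRegular_subscheme_vanishingIdeal_finset`), the transform under `τ : Bl_S Y → Y`
(`blowup.isBlowup`)
is an `n`-datum (`isDatum_transform_blowup`) over a base (`baseStable_holds`), and EVERY wild closed top point `y'` upstairs is
δ-LIGHT — over a bad point by the chain letter read through the splitting `𝓘(S) = 𝓘{y₀}·𝓘(S∖y₀)`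
(`deltaLightAt_of_chainLightAt_fac`),
elsewhere by off-centre invariance (the point below is wild and not bad; `deltaLightAt_transform_iff_of_not_mem`) —
so g23's closing
law `wor_of_splitOrLightOrDeltaLight` finishes and the centre is spliced in front (`CentreSeq.cons`). [new] [folklore] -/
theorem wor_of_chainTame {n : ℕ} (hn : 1 ≤ n) (h5 : SeqDimFour 5 n) (p : ℕ) (hp : p.Prime) (k : Type) [Field k]
    [CharP k p] (Y : Scheme.{0}) (g : Y ⟶ Spec (.of k)) (hB : IsBase Y g) (M : MarkedIdeal Y) (hM : IsDatum n M)
    (htame : (badSet M n).Finite ∧ ∀ y ∈ badSet M n, ChainLightAt M.ideal n y) :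
    ∃ t : CentreSeq Y, WeakResolution t M := by
  haveI : Fact p.Prime := ⟨hp⟩
  haveI := hB.locallyOfFiniteType
  haveI : IsLocallyNoetherian Y := LocallyOfFiniteType.isLocallyNoetherian g
  have hSfin : (badSet M n).Finite := htame.1
  obtain ⟨s, hs⟩ := hSfin.exists_finset_coe
  have hcl : ∀ y ∈ s, IsClosed ({y} : Set Y) := fun y hy => by
    have hy' : y ∈ badSet M n := by rw [← hs]; exact hy
    exact hy'.1.1
  have hSc : IsClosed ((s : Set Y)) := isClosed_of_finite_of_isClosed_singleton s.finite_toSet hcl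
  have hCsupp : ((vanishingIdeal ⟨(s : Set Y), hSc⟩).support : Set Y) = badSet M n := by
    rw [coe_support_vanishingIdeal]; exact hs
  have hCreg : Scheme.IsRegular (vanishingIdeal ⟨(s : Set Y), hSc⟩).subscheme :=
    isRegular_subscheme_vanishingIdeal_finset s hcl hSc
  -- name the centre
  generalize hCdef : vanishingIdeal ⟨(s : Set Y), hSc⟩ = C at hCsupp hCreg
  have hCsub : (C.support : Set Y) ⊆ M.support := by
    rw [hCsupp]; intro y hy
    show (M.mult : ℕ∞) ≤ idealOrder M.ideal y
    rw [hM.1, hy.1.2.1]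
  have hπ := blowup.isBlowup C
  have hB₁ : IsBase (blowup C) (blowup.π C ≫ g) := baseStable_holds k Y g hB C hCreg
  haveI : IsLocallyNoetherian (blowup C) := hπ.isLocallyNoetherian
  have hM₁ : IsDatum n (M.transform (blowup.π C) C) :=
    isDatum_transform_blowup hB hM hCreg fun y hy => by
      have hy' : y ∈ (C.support : Set Y) := hy
      rw [hCsupp] at hy'
      exact hy'.1.2.1
  have hall : ∀ y' ∈ wildSet (M.transform (blowup.π C) C) n, DeltaLightAt (M.transform (blowup.π C) C).ideal n y' := by
    intro y' hw
    obtain ⟨hy'c, hord, hna⟩ := hw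
    rw [MarkedIdeal.transform_ideal, hM.1] at hord hna ⊢
    by_cases hyS : (blowup.π C).base y' ∈ badSet M n
    · -- over a bad point `y₀`: split the centre as `{y₀} ⊔ (S ∖ {y₀})` and read the chain letter at `y₀`
      have hy₀c : IsClosed ({(blowup.π C).base y'} : Set Y) := hyS.1.1
      have hS₂c : IsClosed (badSet M n \ {(blowup.π C).base y'}) :=
        isClosed_of_finite_of_isClosed_singleton (hSfin.subset fun _ hy => hy.1) fun y hy => hy.1.1.1
      have hy₀Z₂ : (blowup.π C).base y' ∉ ((⟨badSet M n \ {(blowup.π C).base y'}, hS₂c⟩ : Closeds Y) : Set Y) :=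
        fun h => h.2 rfl
      have hZeq : (⟨(s : Set Y), hSc⟩ : Closeds Y) =
          (⟨{(blowup.π C).base y'}, hy₀c⟩ : Closeds Y) ⊔ ⟨badSet M n \ {(blowup.π C).base y'}, hS₂c⟩ :=
        Closeds.ext (by
          rw [Closeds.coe_sup]
          show (s : Set Y) = {(blowup.π C).base y'} ∪ (badSet M n \ {(blowup.π C).base y'})
          rw [hs]
          ext x
          rw [Set.mem_union, Set.mem_sdiff, Set.mem_singleton_iff]
          refine ⟨fun hx => ?_, ?_⟩
          · by_cases hxy : x = (blowup.π C).base y'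
            · exact Or.inl hxy
            · exact Or.inr ⟨hx, hxy⟩
          · rintro (hxy | ⟨hx, -⟩)
            · rw [hxy]; exact hyS
            · exact hx)
      have hCmul : C = vanishingIdeal ⟨{(blowup.π C).base y'}, hy₀c⟩ *
          vanishingIdeal ⟨badSet M n \ {(blowup.π C).base y'}, hS₂c⟩ := by
        refine hCdef.symm.trans ?_
        rw [hZeq, vanishingIdeal_sup_eq_mul_of_disjoint]
        exact Set.disjoint_singleton_left.mpr hy₀Z₂
      have hct : controlledTransform (blowup.π C) C M.ideal n = controlledTransform (blowup.π C)
          (vanishingIdeal ⟨{(blowup.π C).base y'}, hy₀c⟩ * vanishingIdeal ⟨badSet M n \ {(blowup.π C).base y'}, hS₂c⟩)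
          M.ideal n :=
        congrArg (fun c => controlledTransform (blowup.π C) c M.ideal n) hCmul
      have hπ' : IsBlowup (blowup.π C) (vanishingIdeal ⟨{(blowup.π C).base y'}, hy₀c⟩ *
          vanishingIdeal ⟨badSet M n \ {(blowup.π C).base y'}, hS₂c⟩) := by
        rw [← hCmul]; exact hπ
      rw [hct] at hord hna ⊢
      exact deltaLightAt_of_chainLightAt_fac hy₀c hy₀Z₂ hπ' (htame.2 _ hyS) rfl hy'c hord hna
    · -- off the bad set: the point below is wild (transport) and not bad, hence δ-light; transport up
      have hy'C : (blowup.π C).base y' ∉ (C.support : Set Y) := by rw [hCsupp]; exact hyS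
      haveI := hπ.isProper
      have hwb : (blowup.π C).base y' ∈ wildSet M n := by
        refine ⟨?_, ?_, ?_⟩
        · have := (blowup.π C).isClosedMap _ hy'c
          rwa [Set.image_singleton] at this
        · rw [← hπ.idealOrder_controlledTransform_of_not_mem M.ideal n hy'C]; exact hord
        · rw [isAbsContactAt_transform_iff_of_not_mem hπ M.ideal n n hy'C] at hna; exact hna
      have hdl : DeltaLightAt M.ideal n ((blowup.π C).base y') := by
        by_contra h
        exact hyS ⟨hwb, h⟩
      exact (deltaLightAt_transform_iff_of_not_mem hπ M.ideal n n hy'C).2 hdl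
  obtain ⟨t', ht'⟩ := wor_of_splitOrLightOrDeltaLight hn h5 p hp k (blowup C) (blowup.π C ≫ g) hB₁
    (M.transform (blowup.π C) C) hM₁ (fun y' hw => Or.inr (hall y' hw))
  exact ⟨CentreSeq.cons C t', ⟨hCsub, hCreg, ht'.1⟩, ht'.2⟩

/-- **ISOLATION SUFFICES** (the g23-scoped form of the decided condition): every bad point ISOLATED in the top locus
and CHAIN-LIGHT
⟹ weak resolution, given `SeqDimFour 5 n` (`badSet_finite_of_isolated` + the engine). [new] [folklore] -/
theorem wor_of_isolated_chainTame {n : ℕ} (hn : 1 ≤ n) (h5 : SeqDimFour 5 n) (p : ℕ) (hp : p.Prime) (k : Type) [Field k]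
    [CharP k p] (Y : Scheme.{0}) (g : Y ⟶ Spec (.of k)) (hB : IsBase Y g) (M : MarkedIdeal Y) (hM : IsDatum n M)
    (htame : ∀ y ∈ badSet M n, IsIsolatedIn M.support y ∧ ChainLightAt M.ideal n y) :
    ∃ t : CentreSeq Y, WeakResolution t M :=
  wor_of_chainTame hn h5 p hp k Y g hB M hM
    ⟨badSet_finite_of_isolated orderUSC_holds hB hM fun y hy => (htame y hy).1, fun y hy => (htame y hy).2⟩

/-- **THE DECIDED CELL IS PROVED from `SeqDimFour 5 n`.** [new] [folklore] -/
theorem worTopDeltaHeavyChainTame_of_five {n : ℕ} (hn : 1 ≤ n) (h5 : SeqDimFour 5 n) : WORTopDeltaHeavyChainTame n :=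
  fun p hp k _ _ Y g hB M hM _ _ hnc => wor_of_chainTame hn h5 p hp k Y g hB M hM (not_topChainHeavy_iff.1 hnc)

/-- **THE DECIDED family is PROVED from `E 5`** (tree: `E 5` ⟸ CJS (R), `e_five_of_RCJS`). [new] [folklore] -/
theorem e1TopDeltaHeavyChainTame_of_five (h5 : E 5) : E1TopDeltaHeavyChainTame :=
  fun n hn => worTopDeltaHeavyChainTame_of_five hn (h5 n hn)

/-- **RE-LOCATION OF THE RESIDUAL (rule (C))**: under `E 5`, `E1TopDeltaHeavy ⟺ E1TopChainHeavy` — the open booked residual of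
row 181 is EQUIVALENT to its strictly sharper typed sub-class «infinitely many bad points, or a bad point with a
wild δ-heavy near
point». [new] [folklore] -/
theorem e1TopDeltaHeavy_iff_e1TopChainHeavy (h5 : E 5) : E1TopDeltaHeavy ↔ E1TopChainHeavy :=
  ⟨fun h => (e1TopDeltaHeavy_iff_chainHeavy_chainTame.1 h).1,
    fun h => e1TopDeltaHeavy_iff_chainHeavy_chainTame.2 ⟨h, e1TopDeltaHeavyChainTame_of_five h5⟩⟩

/-- Per marking: under `SeqDimFour 5 n`, `WORTopDeltaHeavy n ⟺ WORTopChainHeavy n`. [new] [folklore] -/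
theorem worTopDeltaHeavy_iff_worTopChainHeavy {n : ℕ} (hn : 1 ≤ n) (h5 : SeqDimFour 5 n) :
    WORTopDeltaHeavy n ↔ WORTopChainHeavy n :=
  ⟨fun h => ((worTopDeltaHeavy_iff_chainHeavy_chainTame n).1 h).1,
    fun h => (worTopDeltaHeavy_iff_chainHeavy_chainTame n).2 ⟨h, worTopDeltaHeavyChainTame_of_five hn h5⟩⟩

/-- **THE WHOLE COLUMN after g24**: under `E 5`, `E1TopHeavy ⟺ E1TopChainHeavy` (g23's
`e1TopHeavy_iff_e1TopDeltaHeavy` ∘ g24). [new] [folklore] -/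
theorem e1TopHeavy_iff_e1TopChainHeavy (h5 : E 5) : E1TopHeavy ↔ E1TopChainHeavy :=
  (e1TopHeavy_iff_e1TopDeltaHeavy h5).trans (e1TopDeltaHeavy_iff_e1TopChainHeavy h5)

/-- **DOWN-LINK TO ITEM 26971's CLASS** (tree `LightCutClasses.e1TopNoAbs_iff_e1TopHeavy` ∘ g24): under `SubfieldContactAbs` and
`E 5`, `E1TopNoAbs ⟺ E1TopChainHeavy`. [new] [folklore] -/
theorem e1TopNoAbs_iff_e1TopChainHeavy (hSC : SubfieldContactAbs) (h5 : E 5) : E1TopNoAbs ↔ E1TopChainHeavy :=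
  (e1TopNoAbs_iff_e1TopHeavy hSC h5).trans (e1TopHeavy_iff_e1TopChainHeavy h5)

/-- **SUMMIT EDGE after g24** (tree `LightCutClasses.e_one_iff_e1TopHeavy` ∘ g24): under `SubfieldContactAbs` and `E 5`,
`E 1 ⟺ E1TopChainHeavy` — the column's ONE open statement is the chain residual. [new] [folklore] -/
theorem e_one_iff_e1TopChainHeavy (hSC : SubfieldContactAbs) (h5 : E 5) : E 1 ↔ E1TopChainHeavy :=
  (e_one_iff_e1TopHeavy hSC h5).trans (e1TopHeavy_iff_e1TopChainHeavy h5)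

end ChainEngine

section ChainSubCells

open Summit.ResolutionOfSingularities.ResolutionOfSingularities.Theorems
open WeakOrderReduction ForcedTowerClasses SubfieldContactClasses AbsoluteContactClasses PurityValveClasses

/-! ### The residual split BY LETTER (typed DISJOINT sub-loci, hypothesis-free): the INFINITE-BAD-SET kind (infinitely many bad
points — e.g. a CURVE of bad points, C_ax) and the FINITE-CHAIN kind (finitely many bad points, one of them CHAIN-HEAVY — B_S).
The split is a 0-weight located remainder (no law decides either kind here); its cells carve `WORTopChainHeavy` exactly. -/

/-- **`TopBadInfinite Y 𝓘 n`** — INFINITELY MANY bad points (closed, `ord = n`, no absolute stalk contact, not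
δ-light): the kind no
finite centre of closed points can touch (inhabitant C_ax = `z³ + t⁴ + u⁴`: the whole `w`-axis is bad). DEFINITION
(residual sub-locus,
finiteness letter). -/
def TopBadInfinite (Y : Scheme.{0}) (I : Y.IdealSheafData) (n : ℕ) : Prop :=
  (badLocus Y I n).Infinite

/-- **`TopFiniteChainHeavy Y 𝓘 n`** — FINITELY many bad points, one of which is NOT chain-light (has a WILD δ-HEAVY
near point: a
δ-heavy wild near-point chain of length `2`; inhabitant B_S = `z³ + t⁷ + u⁷ + w⁷`). DEFINITION (residual sub-locus,
chain letter). -/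
def TopFiniteChainHeavy (Y : Scheme.{0}) (I : Y.IdealSheafData) (n : ℕ) : Prop :=
  (badLocus Y I n).Finite ∧ ∃ y ∈ badLocus Y I n, ¬ ChainLightAt I n y

/-- **THE RESIDUAL LOCUS SPLITS BY LETTER** (hypothesis-free): `TopChainHeavy ⟺ TopBadInfinite ∨
TopFiniteChainHeavy`. [new] [folklore] -/
theorem topChainHeavy_iff_badInfinite_or_finiteChainHeavy (Y : Scheme.{0}) (I : Y.IdealSheafData) (n : ℕ) :
    TopChainHeavy Y I n ↔ TopBadInfinite Y I n ∨ TopFiniteChainHeavy Y I n := by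
  unfold TopChainHeavy TopBadInfinite TopFiniteChainHeavy
  constructor
  · rintro (h | h)
    · exact Or.inl h
    · by_cases hf : (badLocus Y I n).Finite
      · exact Or.inr ⟨hf, h⟩
      · exact Or.inl hf
  · rintro (h | ⟨-, h⟩)
    · exact Or.inl h
    · exact Or.inr h

/-- The two kinds are DISJOINT. [new] [folklore] -/
theorem not_topBadInfinite_and_topFiniteChainHeavy (Y : Scheme.{0}) (I : Y.IdealSheafData) (n : ℕ) :
    ¬ (TopBadInfinite Y I n ∧ TopFiniteChainHeavy Y I n) :=
  fun h => h.1 h.2.1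

/-- Chain-heavy and not of the infinite kind ⟹ of the finite-chain kind. [folklore] -/
theorem topFiniteChainHeavy_of_not_topBadInfinite {Y : Scheme.{0}} {I : Y.IdealSheafData} {n : ℕ} (h : TopChainHeavy Y I n)
    (hc : ¬ TopBadInfinite Y I n) : TopFiniteChainHeavy Y I n :=
  ((topChainHeavy_iff_badInfinite_or_finiteChainHeavy Y I n).1 h).resolve_left hc

/-- **THE INFINITE-BAD-SET sub-cell · `WORTopBadInfinite n`**: the chain-heavy data with INFINITELY MANY bad points.
RESIDUAL (sub-cell;
inhabited by C_ax, `Cax_curve_certificate`). -/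
def WORTopBadInfinite (n : ℕ) : Prop :=
  ∀ p : ℕ, p.Prime → ∀ (k : Type) [Field k] [CharP k p] (Y : Scheme.{0}) (g : Y ⟶ Spec (.of k)),
    IsBase Y g → ∀ M : MarkedIdeal Y, IsDatum n M → TopHeavy Y M.ideal n → TopDeltaHeavy Y M.ideal n →
      TopChainHeavy Y M.ideal n → TopBadInfinite Y M.ideal n → ∃ t : CentreSeq Y, WeakResolution t M

/-- **THE FINITE-CHAIN sub-cell · `WORTopFiniteChainHeavy n`**: the chain-heavy data with FINITELY many bad points
(so some bad point
has a WILD δ-HEAVY NEAR POINT: a δ-heavy wild near-point chain of length `2`). RESIDUAL (sub-cell; inhabited by B_S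
= `z³ + t⁷ + u⁷ + w⁷`,
`BS_chain_certificate`). -/
def WORTopFiniteChainHeavy (n : ℕ) : Prop :=
  ∀ p : ℕ, p.Prime → ∀ (k : Type) [Field k] [CharP k p] (Y : Scheme.{0}) (g : Y ⟶ Spec (.of k)),
    IsBase Y g → ∀ M : MarkedIdeal Y, IsDatum n M → TopHeavy Y M.ideal n → TopDeltaHeavy Y M.ideal n →
      TopChainHeavy Y M.ideal n → ¬ TopBadInfinite Y M.ideal n → ∃ t : CentreSeq Y, WeakResolution t M

/-- Families. RESIDUAL (sub-cells). -/
def E1TopBadInfinite : Prop := ∀ n : ℕ, 1 ≤ n → WORTopBadInfinite n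

/-- Families. RESIDUAL (sub-cells). -/
def E1TopFiniteChainHeavy : Prop := ∀ n : ℕ, 1 ≤ n → WORTopFiniteChainHeavy n

end ChainSubCells

end Summit.ResolutionOfSingularities.ResolutionOfSingularities.Theorems.DeltaCutClasses
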